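import Summits.MatrixMultiplication.MatrixMultiplication.Theorems.SoloInformedTwistedMatchingsAbelian
import Mathlib.Combinatorics.Additive.AP.Three.Behrend
import HarnessLib

/-!
# Large induced matchings of `supp ⟨n,n,n⟩` from progression-free sets, and the quantitative
# no-go for translation schemes over abelian `p`-groups of bounded exponent

Solo-informed seat (MatrixMultiplication), gen 101; closes the kernel form of the seat's Theorem B″
(sharpest-statement §2y(8)). A set `t ⊆ [0,N)` without three-term arithmetic progressions gives the
corner-free set `{(a + y, y) : a ∈ t, y < N}` and hence an INDUCED MATCHING of the support of
`⟨3N,3N,3N⟩` of size `|t|·N` (`threeAPFree_inducedMatching`): the triples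
`(a_i, b_i, c_i) = (a + y, y, a + 2y)` satisfy `b_j = b_i ∧ c_l = c_j ∧ a_l = a_i ⟹ i = j = l`.
With `rothNumberNat` and Behrend's bound `N e^{-4√log N} ≤ r₃(N)` (Mathlib) and
`realization_abelianTwisted_inducedMatching_card_le`:

* `realization_card_ge_roth` — if `α, β, γ : [3N]² → S` realize `⟨3N,3N,3N⟩` (Cohn–Umans 2013,
  Def. 12) for the twisted triangle predicate of a finite family of automorphism pairs of a finite
  abelian group `S` with `g^{p^E} = 1`, then `r₃(N) · N ≤ 3 |S|^{1-δ}`, `δ = δ(p,E) > 0`;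
* `realization_card_ge_behrend` — hence `N² e^{-4√log N} ≤ 3 |S|^{1-δ}`: translation schemes
  `𝒮(S, M₀)` over abelian `p`-groups of bounded exponent, WHATEVER the multiplier group `M₀ ≤ Aut S`,
  realize `⟨n,n,n⟩` only when `|S| ≥ n^{(2-o(1))/(1-δ)}` — polynomially more than the `n^{2+o(1)}`
  that Cohn–Umans Conj. 21 would need from the rank `≥ |S|/|M₀|` unless `|M₀| ≥ |S|^{δ-o(1)}`.

References: CohnUmans2013 (arXiv:1207.6528) Def. 12, §5, Conj. 21; Behrend, Proc. Nat. Acad. Sci.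
32 (1946); ChristandlFawziTaZuiddam (arXiv:2111.08262) §1 (induced matchings of `⟨n,n,n⟩` vs corners).
-/

noncomputable section

open scoped BigOperators
open Finset Literature.Combinatorics.Additive Literature.Barriers.MatrixMultiplication

namespace Summit.MatrixMultiplication.MatrixMultiplication.Theorems.TwistedSliceRank

section Corners

/-- **Induced matchings of the matrix-multiplication support from progression-free sets.** For a
`3`-AP-free `t ⊆ [0,N)` the family `i = (a, y) ↦ (a_i, b_i, c_i) = (a + y, y, a + 2y)` in `[0,3N)³`,
indexed by `t × [0,N)`, is an induced matching of `supp ⟨3N,3N,3N⟩`: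
`b_j = b_i ∧ c_l = c_j ∧ a_l = a_i ⟹ i = j = l` (the three equalities force the `3`-term
progression `(a_l, a_i, a_j)` in `t`). [this work] -/
theorem threeAPFree_inducedMatching {N : ℕ} {t : Finset ℕ} (ht : ThreeAPFree (t : Set ℕ))
    (htN : t ⊆ Finset.range N) :
    ∃ (a b c : ↥t × Fin N → Fin (3 * N)),
      (∀ i, (a i : ℕ) = (i.1 : ℕ) + i.2 ∧ (b i : ℕ) = i.2 ∧ (c i : ℕ) = (i.1 : ℕ) + 2 * i.2) ∧
      ∀ i j l, b j = b i → c l = c j → a l = a i → i = j ∧ j = l := by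
  have hlt : ∀ i : ↥t × Fin N, (i.1 : ℕ) < N := fun i => Finset.mem_range.1 (htN i.1.2)
  refine ⟨fun i => ⟨(i.1 : ℕ) + i.2, by have := hlt i; have := i.2.isLt; omega⟩,
    fun i => ⟨i.2, by have := i.2.isLt; omega⟩,
    fun i => ⟨(i.1 : ℕ) + 2 * i.2, by have := hlt i; have := i.2.isLt; omega⟩,
    fun i => ⟨rfl, rfl, rfl⟩, ?_⟩
  intro i j l h1 h2 h3
  have e1 : ((j.2 : ℕ)) = i.2 := by have h := congrArg Fin.val h1; exact h
  have e2 : (l.1 : ℕ) + 2 * l.2 = j.1 + 2 * j.2 := by have h := congrArg Fin.val h2; exact h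
  have e3 : (l.1 : ℕ) + l.2 = i.1 + i.2 := by have h := congrArg Fin.val h3; exact h
  -- `(l.1, i.1, j.1)` is a three-term progression in `t`
  have hap : (l.1 : ℕ) + j.1 = i.1 + i.1 := by omega
  have h4 : (l.1 : ℕ) = i.1 := ht l.1.2 i.1.2 j.1.2 hap
  exact ⟨Prod.ext (Subtype.ext (by omega)) (Fin.ext e1.symm),
    Prod.ext (Subtype.ext (by omega)) (Fin.ext (by omega))⟩

end Corners

section Quantitative

/-- **Realizations over abelian `p`-groups of bounded exponent are polynomially wasteful (Roth
form).** With `δ = δ(p,E) > 0` of `realization_abelianTwisted_inducedMatching_card_le`: a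
Cohn–Umans realization of `⟨3N,3N,3N⟩` by the twisted triangle predicate of finitely many
automorphism pairs of a finite abelian group `S` with `g^{p^E} = 1` forces `r₃(N)·N ≤ 3|S|^{1-δ}`.
[this work] -/
theorem realization_card_ge_roth (p : ℕ) [Fact p.Prime] (E : ℕ) :
    ∃ δ : ℝ, 0 < δ ∧ ∀ (S : Type) [CommGroup S] [Fintype S] [DecidableEq S],
      (∀ g : S, g ^ p ^ E = 1) →
      ∀ (σ : Type) [Fintype σ] (φ ψ : σ → S ≃* S) (N : ℕ)
        (α β γ : Fin (3 * N) × Fin (3 * N) → S),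
      (∀ x y z : Fin (3 * N) × Fin (3 * N), (∃ s : σ, α x * φ s (β y) * ψ s (γ z) = 1) ↔
          (y.1 = x.2 ∧ z = (y.2, x.1))) →
      ((rothNumberNat N : ℝ) * N) ≤ 3 * (Fintype.card S : ℝ) ^ (1 - δ) := by
  obtain ⟨δ, hδ0, hmain⟩ := realization_abelianTwisted_inducedMatching_card_le p E
  refine ⟨δ, hδ0, fun S _ _ _ hexpS σ _ φ ψ N α β γ hreal => ?_⟩
  obtain ⟨t, htN, htcard, ht⟩ := rothNumberNat_spec N
  obtain ⟨a, b, c, -, hind⟩ := threeAPFree_inducedMatching ht htN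
  have h := hmain S hexpS σ φ ψ (3 * N) α β γ hreal (↥t × Fin N) a b c hind
  have hcard : Fintype.card (↥t × Fin N) = rothNumberNat N * N := by
    rw [Fintype.card_prod, Fintype.card_coe, htcard, Fintype.card_fin]
  rw [hcard] at h
  exact_mod_cast h

/-- **Behrend form**: under the same hypotheses `N² e^{-4√(log N)} ≤ 3 |S|^{1-δ}` — a translation
scheme over an abelian `p`-group of bounded exponent realizes `⟨n,n,n⟩` only if
`|S| ≥ n^{(2-o(1))/(1-δ)}`, uniformly in the multiplier group (sharpest-statement §2y(8),
Theorem B″: Cohn–Umans Conj. 21 then needs `|M₀| ≥ |S|^{δ-o(1)}`). [this work] -/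
theorem realization_card_ge_behrend (p : ℕ) [Fact p.Prime] (E : ℕ) :
    ∃ δ : ℝ, 0 < δ ∧ ∀ (S : Type) [CommGroup S] [Fintype S] [DecidableEq S],
      (∀ g : S, g ^ p ^ E = 1) →
      ∀ (σ : Type) [Fintype σ] (φ ψ : σ → S ≃* S) (N : ℕ)
        (α β γ : Fin (3 * N) × Fin (3 * N) → S),
      (∀ x y z : Fin (3 * N) × Fin (3 * N), (∃ s : σ, α x * φ s (β y) * ψ s (γ z) = 1) ↔
          (y.1 = x.2 ∧ z = (y.2, x.1))) →
      ((N : ℝ) ^ 2 * Real.exp (-4 * Real.sqrt (Real.log N))) ≤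
        3 * (Fintype.card S : ℝ) ^ (1 - δ) := by
  obtain ⟨δ, hδ0, hmain⟩ := realization_card_ge_roth p E
  refine ⟨δ, hδ0, fun S _ _ _ hexpS σ _ φ ψ N α β γ hreal => ?_⟩
  have h := hmain S hexpS σ φ ψ N α β γ hreal
  have hB : (N : ℝ) * Real.exp (-4 * Real.sqrt (Real.log N)) ≤ rothNumberNat N :=
    Behrend.roth_lower_bound
  have hN : (0 : ℝ) ≤ N := Nat.cast_nonneg N
  calc (N : ℝ) ^ 2 * Real.exp (-4 * Real.sqrt (Real.log N))
      = ((N : ℝ) * Real.exp (-4 * Real.sqrt (Real.log N))) * N := by ring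
    _ ≤ (rothNumberNat N : ℝ) * N := mul_le_mul_of_nonneg_right hB hN
    _ ≤ 3 * (Fintype.card S : ℝ) ^ (1 - δ) := h

end Quantitative

end Summit.MatrixMultiplication.MatrixMultiplication.Theorems.TwistedSliceRank
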